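import Mathlib
import Literature.NumberTheory.Automorphic.ResGLnHermitianConeGauge
import Literature.NumberTheory.Automorphic.ResGLnCohomology
import Literature.NumberTheory.Automorphic.SiegelReducedFamilies
import HarnessLib

/-!
# The entry gauge on the hermitian cone of `Res_{K/ℚ} GL_n`: determinant and scaling bounds;
# scale invariance of reduced families; the totally positive part of a rational group

Topic `NumberTheory/Automorphic`; namespace `Literature.NumberTheory.Automorphic`, with the grouping
sub-namespaces `ResGLnCone` (statements about the cone `posCone n K` of positive hermitian matrices
over `K_∞ = mixedSpace K`, `ResGLnHermitianCone.lean`), `SiegelFamily` (reduced families,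
`SiegelReducedFamilies.lean`) and `ResGLnCohomology` (`glTotPos`, `ResGLnCohomology.lean`).
Theorems only.  Elementary estimates for Borel's regularisation of invariant forms by radial
projection and averaging [Borel1983Regularization, §3.5], [Borel1969, §12]; the entry gauge is
`E(H) = 1 + ∑_{i,j} (‖H i j‖ + ‖(H⁻¹) i j‖)` (`ResGLnHermitianConeGauge.lean`).

* `ResGLnCone.one_le_entryGauge`, `sum_norm_le_entryGauge`, `norm_le_entryGauge`,
  `entryGauge_smul_le` — `E ≥ 1`, the entry sums and the sup norm are `≤ E`, and
  `E(r H) ≤ (r + r⁻¹) E(H)` for `r > 0`;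
* `norm_det_le_sum`, `mixedNorm_det_le` — `‖det M‖ ≤ n! (∑‖M i j‖)ⁿ` and
  `N_{K_∞/ℝ}(det M) ≤ (n! (∑‖M i j‖)ⁿ)^{[K:ℚ]}`;
* `isUnit_coe_of_mem_posCone`, `smul_mem_posCone`, `entryGauge_cone_bounds`, `entryGauge_radial_le` —
  a point of the cone is an invertible matrix, `N(H) = N_{K_∞/ℝ}(det H)`, `N(H)⁻¹` and `1 + ‖H‖ + N(H)⁻¹` are
  `≤ C E(H)ᵏ`, and the radial projection `H ↦ N(H)^{-e} H` (`0 < e ≤ 1`) changes `E` polynomially;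
* `opNorm_fderiv_le_of_applied` — operator norms of `Dp, D²p` from applied bounds (generic);
* `SiegelFamily.schur_smul`, `SiegelFamily.isReduced_smul_iff` — `(c, C, τ)`-reducedness is invariant
  under positive real scalings;
* `ResGLnCohomology.finiteIndex_subgroupOf_glTotPos` — `G ∩ GL_n(K)⁺` has finite index in any
  `G ≤ GL_n(K)` (the real sign characters of `det`).

## References

* A. Borel, *Regularization theorems in Lie algebra cohomology. Applications*, Duke Math. J. 50
  (1983), §3.5. [Borel1983Regularization]
* A. Borel, *Introduction aux groupes arithmétiques*, Hermann (1969), §1, §12. [Borel1969]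
-/

noncomputable section

open Set NumberField NumberField.mixedEmbedding
open scoped Matrix Classical

namespace Literature.NumberTheory.Automorphic

/-! ### The entry gauge: entry sums, sup norm, scalings, determinants -/

namespace ResGLnCone

section Gauge

variable {n : ℕ} {K : Type} [Field K] [NumberField K]

/-- **The entry gauge under positive scalings**: `E(r H) ≤ (r + r⁻¹) E(H)` for `r > 0` and `H` with
unit determinant (`(r H)⁻¹ = r⁻¹ H⁻¹`). [folklore] -/
theorem entryGauge_smul_le {r : ℝ} (hr : 0 < r) (H : Matrix (Fin n) (Fin n) (mixedSpace K))
    (hH : IsUnit H.det) :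
    (1 + ∑ i, ∑ j, (‖(r • H) i j‖ + ‖(r • H)⁻¹ i j‖)) ≤
      (r + r⁻¹) * (1 + ∑ i, ∑ j, (‖H i j‖ + ‖H⁻¹ i j‖)) := by
  have hinv : (r • H)⁻¹ = r⁻¹ • H⁻¹ := by
    refine Matrix.inv_eq_right_inv ?_
    rw [Matrix.smul_mul, Matrix.mul_smul, smul_smul, mul_inv_cancel₀ hr.ne', one_smul,
      Matrix.mul_nonsing_inv _ hH]
  have hr1 : 1 ≤ r + r⁻¹ := by
    rcases le_or_gt 1 r with h | h
    · linarith [inv_pos.2 hr]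
    · linarith [(one_le_inv₀ hr).2 h.le]
  have hS0 : 0 ≤ ∑ i, ∑ j, (‖H i j‖ + ‖H⁻¹ i j‖) :=
    Finset.sum_nonneg fun i _ => Finset.sum_nonneg fun j _ => add_nonneg (norm_nonneg _) (norm_nonneg _)
  rw [hinv]
  calc (1 + ∑ i, ∑ j, (‖(r • H) i j‖ + ‖(r⁻¹ • H⁻¹) i j‖))
      ≤ 1 + ∑ i, ∑ j, (r + r⁻¹) * (‖H i j‖ + ‖H⁻¹ i j‖) := by
        gcongr with i _ j _
        rw [Matrix.smul_apply, Matrix.smul_apply, _root_.norm_smul, _root_.norm_smul, Real.norm_of_nonneg hr.le,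
          Real.norm_of_nonneg (inv_pos.2 hr).le]
        nlinarith [norm_nonneg (H i j), norm_nonneg (H⁻¹ i j), inv_pos.2 hr]
    _ = 1 + (r + r⁻¹) * ∑ i, ∑ j, (‖H i j‖ + ‖H⁻¹ i j‖) := by
        rw [Finset.mul_sum]
        exact congrArg _ (Finset.sum_congr rfl fun i _ => (Finset.mul_sum _ _ _).symm)
    _ ≤ (r + r⁻¹) * (1 + ∑ i, ∑ j, (‖H i j‖ + ‖H⁻¹ i j‖)) := by nlinarith

/-- **Determinants are polynomially bounded by the entry sum**: `‖det M‖ ≤ n! (∑ ‖M i j‖)ⁿ`.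
[folklore] -/
theorem norm_det_le_sum (hn : 0 < n) (M : Matrix (Fin n) (Fin n) (mixedSpace K)) :
    ‖M.det‖ ≤ (n.factorial : ℝ) * (∑ i, ∑ j, ‖M i j‖) ^ n := by
  haveI : Nonempty (Fin n) := ⟨⟨0, hn⟩⟩
  have hS0 : 0 ≤ ∑ i, ∑ j, ‖M i j‖ := Finset.sum_nonneg fun i _ => Finset.sum_nonneg fun j _ => norm_nonneg _
  rw [Matrix.det_apply]
  calc ‖∑ σ : Equiv.Perm (Fin n), Equiv.Perm.sign σ • ∏ i, M (σ i) i‖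
      ≤ ∑ σ : Equiv.Perm (Fin n), ‖Equiv.Perm.sign σ • ∏ i, M (σ i) i‖ := norm_sum_le _ _
    _ ≤ ∑ _σ : Equiv.Perm (Fin n), (∑ i, ∑ j, ‖M i j‖) ^ n := by
        refine Finset.sum_le_sum fun σ _ => ?_
        have hsign : ‖Equiv.Perm.sign σ • ∏ i, M (σ i) i‖ = ‖∏ i, M (σ i) i‖ := by
          rcases Int.units_eq_one_or (Equiv.Perm.sign σ) with h | h
          · rw [h, one_smul]
          · rw [h, Units.neg_smul, one_smul, norm_neg]
        rw [hsign]
        calc ‖∏ i, M (σ i) i‖ ≤ ∏ i, ‖M (σ i) i‖ := Finset.norm_prod_le' _ Finset.univ_nonempty _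
          _ ≤ ∏ _i : Fin n, ∑ i, ∑ j, ‖M i j‖ :=
              Finset.prod_le_prod (fun i _ => norm_nonneg _) fun i _ =>
                (Finset.single_le_sum (f := fun j => ‖M (σ i) j‖) (fun _ _ => norm_nonneg _)
                  (Finset.mem_univ i)).trans (Finset.single_le_sum (f := fun i' => ∑ j, ‖M i' j‖)
                  (fun _ _ => Finset.sum_nonneg fun _ _ => norm_nonneg _) (Finset.mem_univ (σ i)))
          _ = (∑ i, ∑ j, ‖M i j‖) ^ n := by
              rw [Finset.prod_const, Finset.card_univ, Fintype.card_fin]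
    _ = (n.factorial : ℝ) * (∑ i, ∑ j, ‖M i j‖) ^ n := by
        rw [Finset.sum_const, Finset.card_univ, Fintype.card_perm, Fintype.card_fin, nsmul_eq_mul]

end Gauge

/-! ### The entry gauge on the positive cone -/

section Cone

variable {n : ℕ} {K : Type} [Field K] [NumberField K]

omit [NumberField K] in
open scoped ComplexOrder in
/-- **A point of the positive cone is an invertible matrix** (its determinant is a unit of `K_∞`:
non-zero at every place). [folklore] -/
theorem isUnit_coe_of_mem_posCone {x : ResGLnCone.hermSpace n K} (hx : x ∈ ResGLnCone.posCone n K) :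
    IsUnit (x : Matrix (Fin n) (Fin n) (mixedSpace K)) := by
  rw [Matrix.isUnit_iff_isUnit_det]
  refine Prod.isUnit_iff.2 ⟨Pi.isUnit_iff.2 fun w => ?_, Pi.isUnit_iff.2 fun w => ?_⟩
  · rw [isUnit_iff_ne_zero, ← mixedSpaceEvalReal_apply, RingHom.map_det, RingHom.mapMatrix_apply]
    exact (hx.1 w).det_pos.ne'
  · rw [isUnit_iff_ne_zero, ← mixedSpaceEvalComplex_apply, RingHom.map_det, RingHom.mapMatrix_apply]
    exact (hx.2 w).det_pos.ne'

/-- The entry gauge is at least `1`. [folklore] -/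
theorem one_le_entryGauge (M : Matrix (Fin n) (Fin n) (mixedSpace K)) :
    (1 : ℝ) ≤ 1 + ∑ i, ∑ j, (‖M i j‖ + ‖M⁻¹ i j‖) :=
  le_add_of_nonneg_right (Finset.sum_nonneg fun _ _ => Finset.sum_nonneg fun _ _ =>
    add_nonneg (norm_nonneg _) (norm_nonneg _))

/-- The entry sums of `M` and of `M⁻¹` are bounded by the gauge. [folklore] -/
theorem sum_norm_le_entryGauge (M : Matrix (Fin n) (Fin n) (mixedSpace K)) :
    ∑ i, ∑ j, ‖M i j‖ ≤ 1 + ∑ i, ∑ j, (‖M i j‖ + ‖M⁻¹ i j‖) ∧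
      ∑ i, ∑ j, ‖M⁻¹ i j‖ ≤ 1 + ∑ i, ∑ j, (‖M i j‖ + ‖M⁻¹ i j‖) := by
  have h : ∑ i, ∑ j, (‖M i j‖ + ‖M⁻¹ i j‖) = (∑ i, ∑ j, ‖M i j‖) + ∑ i, ∑ j, ‖M⁻¹ i j‖ := by
    rw [← Finset.sum_add_distrib]
    exact Finset.sum_congr rfl fun i _ => Finset.sum_add_distrib
  have h1 : 0 ≤ ∑ i, ∑ j, ‖M i j‖ := Finset.sum_nonneg fun _ _ => Finset.sum_nonneg fun _ _ => norm_nonneg _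
  have h2 : 0 ≤ ∑ i, ∑ j, ‖M⁻¹ i j‖ := Finset.sum_nonneg fun _ _ => Finset.sum_nonneg fun _ _ => norm_nonneg _
  rw [h]
  exact ⟨by linarith, by linarith⟩

/-- **The sup norm of a hermitian matrix is bounded by its entry gauge.** [folklore] -/
theorem norm_le_entryGauge (x : ResGLnCone.hermSpace n K) :
    ‖x‖ ≤ 1 + ∑ i, ∑ j, (‖(x : Matrix (Fin n) (Fin n) (mixedSpace K)) i j‖ +
      ‖(x : Matrix (Fin n) (Fin n) (mixedSpace K))⁻¹ i j‖) := by
  have h : ‖x‖ = ‖(show Fin n → Fin n → mixedSpace K from (x : Matrix (Fin n) (Fin n) (mixedSpace K)))‖ := rfl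
  rw [h]
  refine (pi_norm_le_iff_of_nonneg (zero_le_one.trans (one_le_entryGauge _))).2 fun i =>
    (pi_norm_le_iff_of_nonneg (zero_le_one.trans (one_le_entryGauge _))).2 fun j => ?_
  calc ‖(x : Matrix (Fin n) (Fin n) (mixedSpace K)) i j‖ ≤ ∑ i, ∑ j, ‖(x : Matrix (Fin n) (Fin n) (mixedSpace K)) i j‖ :=
        (Finset.single_le_sum (f := fun j => ‖(x : Matrix (Fin n) (Fin n) (mixedSpace K)) i j‖)
          (fun _ _ => norm_nonneg _) (Finset.mem_univ j)).trans
          (Finset.single_le_sum (f := fun i' => ∑ j, ‖(x : Matrix (Fin n) (Fin n) (mixedSpace K)) i' j‖)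
            (fun _ _ => Finset.sum_nonneg fun _ _ => norm_nonneg _) (Finset.mem_univ i))
    _ ≤ _ := (sum_norm_le_entryGauge _).1

/-- `N_{K_∞/ℝ}(det M) ≤ (n! (∑ ‖M i j‖)ⁿ)^{[K:ℚ]}` (`|x|_w ≤ ‖x‖` at every place and
`∑_w [K_w:ℝ] = [K:ℚ]`, then `norm_det_le_sum`). [folklore] -/
theorem mixedNorm_det_le (hn : 0 < n) (M : Matrix (Fin n) (Fin n) (mixedSpace K)) :
    mixedEmbedding.norm M.det ≤ ((n.factorial : ℝ) * (∑ i, ∑ j, ‖M i j‖) ^ n) ^ Module.finrank ℚ K := by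
  -- adapted from `Literature.NumberTheory.Automorphic.mixedEmbedding_norm_le_norm_pow` (ArchimedeanDetIntegral)
  have h : mixedEmbedding.norm M.det ≤ ‖M.det‖ ^ Module.finrank ℚ K := by
    rw [mixedEmbedding.norm_apply, ← NumberField.InfinitePlace.sum_mult_eq, ← Finset.prod_pow_eq_pow_sum]
    refine Finset.prod_le_prod (fun w _ => pow_nonneg (normAtPlace_nonneg _ _) _) fun w _ => ?_
    refine pow_le_pow_left₀ (normAtPlace_nonneg _ _) ?_ _
    rw [norm_eq_sup'_normAtPlace]
    exact Finset.le_sup' (fun w => normAtPlace w M.det) (Finset.mem_univ w)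
  exact h.trans (pow_le_pow_left₀ (norm_nonneg _) (norm_det_le_sum hn M) _)

/-- `t ^ e ≤ 1 + t` for `t > 0` and `0 ≤ e ≤ 1`. [folklore] -/
theorem rpow_le_one_add {t e : ℝ} (ht : 0 < t) (he0 : 0 ≤ e) (he1 : e ≤ 1) : t ^ e ≤ 1 + t := by
  rcases le_or_gt t 1 with h | h
  · exact (Real.rpow_le_one ht.le h he0).trans (le_add_of_nonneg_right ht.le)
  · calc t ^ e ≤ t ^ (1 : ℝ) := Real.rpow_le_rpow_of_exponent_le h.le he1
      _ = t := Real.rpow_one t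
      _ ≤ 1 + t := le_add_of_nonneg_left zero_le_one

/-- **The cone gauges against the entry gauge**: on the positive cone, `N(H) = N_{K_∞/ℝ}(det H)`, its
inverse and the derivative gauge `1 + ‖H‖ + N(H)⁻¹` are `≤ C E(H)ᵏ` (`det` and `det H⁻¹ = (det H)⁻¹` are
polynomial in the entries). [folklore] -/
theorem entryGauge_cone_bounds (hn : 0 < n) :
    ∃ (C : ℝ) (k : ℕ), 1 ≤ C ∧ ∀ x ∈ ResGLnCone.posCone n K,
      mixedEmbedding.norm (x : Matrix (Fin n) (Fin n) (mixedSpace K)).det ≤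
          C * (1 + ∑ i, ∑ j, (‖(x : Matrix (Fin n) (Fin n) (mixedSpace K)) i j‖ +
            ‖(x : Matrix (Fin n) (Fin n) (mixedSpace K))⁻¹ i j‖)) ^ k ∧
      (mixedEmbedding.norm (x : Matrix (Fin n) (Fin n) (mixedSpace K)).det)⁻¹ ≤
          C * (1 + ∑ i, ∑ j, (‖(x : Matrix (Fin n) (Fin n) (mixedSpace K)) i j‖ +
            ‖(x : Matrix (Fin n) (Fin n) (mixedSpace K))⁻¹ i j‖)) ^ k ∧
      (1 + ‖x‖ + (mixedEmbedding.norm (x : Matrix (Fin n) (Fin n) (mixedSpace K)).det)⁻¹) ≤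
          C * (1 + ∑ i, ∑ j, (‖(x : Matrix (Fin n) (Fin n) (mixedSpace K)) i j‖ +
            ‖(x : Matrix (Fin n) (Fin n) (mixedSpace K))⁻¹ i j‖)) ^ k := by
  set d : ℕ := Module.finrank ℚ K with hd
  refine ⟨2 + (n.factorial : ℝ) ^ d, n * d + 1, by linarith [pow_nonneg (Nat.cast_nonneg (n.factorial) : (0 : ℝ) ≤ _) d],
    fun x hx => ?_⟩
  set X : Matrix (Fin n) (Fin n) (mixedSpace K) := (x : Matrix (Fin n) (Fin n) (mixedSpace K)) with hX
  set E : ℝ := 1 + ∑ i, ∑ j, (‖X i j‖ + ‖X⁻¹ i j‖) with hE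
  have hE1 : 1 ≤ E := one_le_entryGauge X
  have hE0 : 0 ≤ E := zero_le_one.trans hE1
  have hf0 : (0 : ℝ) ≤ (n.factorial : ℝ) ^ d := pow_nonneg (Nat.cast_nonneg _) d
  have hu : IsUnit X.det := (Matrix.isUnit_iff_isUnit_det _).1 (isUnit_coe_of_mem_posCone hx)
  -- `N(X) ≤ (n!)^d E^{n d}` and the same for `X⁻¹`
  have hN : ∀ M : Matrix (Fin n) (Fin n) (mixedSpace K), ∑ i, ∑ j, ‖M i j‖ ≤ E →
      mixedEmbedding.norm M.det ≤ (n.factorial : ℝ) ^ d * E ^ (n * d) := by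
    intro M hM
    have hM0 : 0 ≤ ∑ i, ∑ j, ‖M i j‖ := Finset.sum_nonneg fun _ _ => Finset.sum_nonneg fun _ _ => norm_nonneg _
    calc mixedEmbedding.norm M.det ≤ ((n.factorial : ℝ) * (∑ i, ∑ j, ‖M i j‖) ^ n) ^ d := mixedNorm_det_le hn M
      _ ≤ ((n.factorial : ℝ) * E ^ n) ^ d := by gcongr
      _ = (n.factorial : ℝ) ^ d * E ^ (n * d) := by rw [mul_pow, ← pow_mul]
  have hNx : mixedEmbedding.norm X.det ≤ (n.factorial : ℝ) ^ d * E ^ (n * d) := hN X (sum_norm_le_entryGauge X).1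
  have hmul : mixedEmbedding.norm X.det * mixedEmbedding.norm X⁻¹.det = 1 := by
    rw [← map_mul, ← Matrix.det_mul, Matrix.mul_nonsing_inv _ hu, Matrix.det_one, map_one]
  have hNi : (mixedEmbedding.norm X.det)⁻¹ ≤ (n.factorial : ℝ) ^ d * E ^ (n * d) := by
    rw [← eq_inv_of_mul_eq_one_right hmul]
    exact hN X⁻¹ (sum_norm_le_entryGauge X).2
  have hpow : E ^ (n * d) ≤ E ^ (n * d + 1) := pow_le_pow_right₀ hE1 (Nat.le_succ _)
  have hEk : E ≤ E ^ (n * d + 1) := le_self_pow₀ hE1 (Nat.succ_ne_zero _)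
  have h1k : (1 : ℝ) ≤ E ^ (n * d + 1) := one_le_pow₀ hE1
  have hxE : ‖x‖ ≤ E := norm_le_entryGauge x
  refine ⟨?_, ?_, ?_⟩
  · calc mixedEmbedding.norm X.det ≤ (n.factorial : ℝ) ^ d * E ^ (n * d) := hNx
      _ ≤ (2 + (n.factorial : ℝ) ^ d) * E ^ (n * d + 1) := by nlinarith
  · calc (mixedEmbedding.norm X.det)⁻¹ ≤ (n.factorial : ℝ) ^ d * E ^ (n * d) := hNi
      _ ≤ (2 + (n.factorial : ℝ) ^ d) * E ^ (n * d + 1) := by nlinarith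
  · nlinarith

/-- **The radial projection changes the entry gauge polynomially**: `E(N(H)^{-e} H) ≤ C E(H)ᵏ` on the
cone for `0 < e ≤ 1` (`N^{∓e} ≤ 1 + N^{∓1}`). [folklore] -/
theorem entryGauge_radial_le (hn : 0 < n) {e : ℝ} (he0 : 0 < e) (he1 : e ≤ 1) :
    ∃ (C : ℝ) (k : ℕ), ∀ x ∈ ResGLnCone.posCone n K,
      (1 + ∑ i, ∑ j, (‖(((mixedEmbedding.norm (x : Matrix (Fin n) (Fin n) (mixedSpace K)).det) ^ (-e) • x :
            ResGLnCone.hermSpace n K) : Matrix (Fin n) (Fin n) (mixedSpace K)) i j‖ +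
          ‖(((mixedEmbedding.norm (x : Matrix (Fin n) (Fin n) (mixedSpace K)).det) ^ (-e) • x :
            ResGLnCone.hermSpace n K) : Matrix (Fin n) (Fin n) (mixedSpace K))⁻¹ i j‖)) ≤
        C * (1 + ∑ i, ∑ j, (‖(x : Matrix (Fin n) (Fin n) (mixedSpace K)) i j‖ +
            ‖(x : Matrix (Fin n) (Fin n) (mixedSpace K))⁻¹ i j‖)) ^ k := by
  obtain ⟨C, k, hC1, hCk⟩ := entryGauge_cone_bounds (n := n) (K := K) hn
  refine ⟨2 + 2 * C, k + 1, fun x hx => ?_⟩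
  obtain ⟨hN, hNi, -⟩ := hCk x hx
  set X : Matrix (Fin n) (Fin n) (mixedSpace K) := (x : Matrix (Fin n) (Fin n) (mixedSpace K)) with hX
  set E : ℝ := 1 + ∑ i, ∑ j, (‖X i j‖ + ‖X⁻¹ i j‖) with hE
  have hE1 : 1 ≤ E := one_le_entryGauge X
  have hEk1 : 1 ≤ E ^ k := one_le_pow₀ hE1
  set N : ℝ := mixedEmbedding.norm X.det with hNdef
  have hNpos : 0 < N := by
    have h : N⁻¹ ≤ C * E ^ k := hNi
    by_contra hle
    have hN0 : N = 0 := le_antisymm (not_lt.1 hle) (mixedEmbedding.norm_nonneg _)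
    have h1 : N * N⁻¹ = 1 := by
      have hmul : mixedEmbedding.norm X.det * mixedEmbedding.norm X⁻¹.det = 1 := by
        rw [← map_mul, ← Matrix.det_mul, Matrix.mul_nonsing_inv _
          ((Matrix.isUnit_iff_isUnit_det _).1 (isUnit_coe_of_mem_posCone hx)), Matrix.det_one, map_one]
      rw [← eq_inv_of_mul_eq_one_right hmul]
      exact hmul
    rw [hN0, zero_mul] at h1
    exact zero_ne_one h1
  set r : ℝ := N ^ (-e) with hr
  have hrpos : 0 < r := Real.rpow_pos_of_pos hNpos _
  have hcoe : (((r • x : ResGLnCone.hermSpace n K)) : Matrix (Fin n) (Fin n) (mixedSpace K)) = r • X := rfl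
  rw [hcoe]
  have hsum : r + r⁻¹ ≤ (2 + 2 * C) * E ^ k := by
    have h1 : r ≤ 1 + N⁻¹ := by
      rw [hr, Real.rpow_neg hNpos.le, ← Real.inv_rpow hNpos.le]
      exact rpow_le_one_add (inv_pos.2 hNpos) he0.le he1
    have h2 : r⁻¹ ≤ 1 + N := by
      rw [hr, Real.rpow_neg hNpos.le, inv_inv]
      exact rpow_le_one_add hNpos he0.le he1
    nlinarith
  calc (1 + ∑ i, ∑ j, (‖(r • X) i j‖ + ‖(r • X)⁻¹ i j‖)) ≤ (r + r⁻¹) * E :=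
        entryGauge_smul_le hrpos X ((Matrix.isUnit_iff_isUnit_det _).1 (isUnit_coe_of_mem_posCone hx))
    _ ≤ ((2 + 2 * C) * E ^ k) * E := mul_le_mul_of_nonneg_right hsum (zero_le_one.trans hE1)
    _ = (2 + 2 * C) * E ^ (k + 1) := by rw [pow_succ]; ring

end Cone

section Scaling

variable {n : ℕ} {K : Type} [Field K] [NumberField K]

omit [NumberField K] in
open scoped ComplexOrder in
/-- Positive real multiples of a point of the positive cone lie in the cone. [folklore] -/
theorem smul_mem_posCone {c : ℝ} (hc : 0 < c) {H : ResGLnCone.hermSpace n K}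
    (hH : H ∈ ResGLnCone.posCone n K) : c • H ∈ ResGLnCone.posCone n K :=
  -- adapted from the landed RADIAL stub (`stub_radialProjection`, clause (3))
  ⟨fun w => by
    rw [Submodule.coe_smul, Matrix.map_smul (mixedSpaceEvalReal K w) c (fun _ => rfl)]
    exact (hH.1 w).smul hc, fun w => by
    rw [Submodule.coe_smul, Matrix.map_smul (mixedSpaceEvalComplex K w) c (fun _ => rfl)]
    exact (hH.2 w).smul hc⟩

end Scaling

end ResGLnCone

/-! ### Operator norms from applied bounds -/

section OpNorm

variable {W : Type*} [NormedAddCommGroup W] [NormedSpace ℝ W]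

/-- Operator-norm consequences of applied bounds on the first two derivatives of a map:
`‖Dp(y)‖, ‖D²p(y)‖ ≤ |C| Xᵏ`. [folklore] -/
theorem opNorm_fderiv_le_of_applied {p : W → W} {y : W} {C Xy : ℝ} {k : ℕ} (hX : 0 ≤ Xy)
    (h : ∀ v w : W, ‖fderiv ℝ p y v‖ ≤ C * Xy ^ k * ‖v‖ ∧
      ‖iteratedFDeriv ℝ 2 p y ![v, w]‖ ≤ C * Xy ^ k * ‖v‖ * ‖w‖) :
    ‖fderiv ℝ p y‖ ≤ |C| * Xy ^ k ∧ ‖fderiv ℝ (fderiv ℝ p) y‖ ≤ |C| * Xy ^ k := by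
  have hCX : C * Xy ^ k ≤ |C| * Xy ^ k := mul_le_mul_of_nonneg_right (le_abs_self C) (pow_nonneg hX k)
  have h0 : 0 ≤ |C| * Xy ^ k := mul_nonneg (abs_nonneg _) (pow_nonneg hX k)
  refine ⟨ContinuousLinearMap.opNorm_le_bound _ h0 fun v =>
    ((h v v).1.trans (mul_le_mul_of_nonneg_right hCX (norm_nonneg _))), ?_⟩
  refine ContinuousLinearMap.opNorm_le_bound _ h0 fun v =>
    ContinuousLinearMap.opNorm_le_bound _ (mul_nonneg h0 (norm_nonneg _)) fun w => ?_
  have h2 := (h v w).2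
  rw [iteratedFDeriv_two_apply] at h2
  simp only [Fin.isValue, Matrix.cons_val_zero, Matrix.cons_val_one] at h2
  exact h2.trans (mul_le_mul_of_nonneg_right (mul_le_mul_of_nonneg_right hCX (norm_nonneg _)) (norm_nonneg _))

end OpNorm

/-! ### Reduced families are invariant under positive scalings -/

namespace SiegelFamily

section Reduced

variable {ι : Type*}

/-- The Schur complement family of `r • H` is `r • schur H` (`r ≠ 0`). [folklore] -/
theorem schur_smul {m : ℕ} {r : ℝ} (hr : r ≠ 0) (H : ι → Matrix (Fin (m + 1)) (Fin (m + 1)) ℂ) :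
    schur (r • H) = r • schur H := by
  have hr' : (r : ℂ) ≠ 0 := Complex.ofReal_ne_zero.2 hr
  funext w
  ext i j
  simp only [schur_apply, Pi.smul_apply, Matrix.smul_apply, Complex.real_smul]
  rw [show (r : ℂ) * H w i.castSucc (Fin.last m) * ((r : ℂ) * H w (Fin.last m) j.castSucc) =
      (r : ℂ) * ((r : ℂ) * (H w i.castSucc (Fin.last m) * H w (Fin.last m) j.castSucc)) by ring,
    mul_div_mul_left _ _ hr']
  ring

/-- **`(c, C, τ)`-reducedness is invariant under positive real scalings** (all the defining
inequalities are homogeneous of degree one, and `schur (r H) = r schur H`). [folklore] -/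
theorem isReduced_smul_iff (c C τ : ℝ) {r : ℝ} (hr : 0 < r) :
    ∀ {m : ℕ} (H : ι → Matrix (Fin m) (Fin m) ℂ),
      IsReduced c C τ m (r • H) ↔ IsReduced c C τ m H
  | 0, _ => by simp
  | m + 1, H => by
    have hr' : (r : ℂ) ≠ 0 := Complex.ofReal_ne_zero.2 hr.ne'
    have hre : ∀ (w : ι) (i j : Fin (m + 1)), ((r • H) w i j).re = r * (H w i j).re := fun w i j => by
      simp [Complex.real_smul]
    have hnorm : ∀ (w : ι) (i j : Fin (m + 1)), ‖(r • H) w i j‖ = r * ‖H w i j‖ := fun w i j => by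
      simp [Complex.real_smul, abs_of_pos hr]
    rw [isReduced_succ_iff, isReduced_succ_iff, schur_smul hr.ne' H,
      isReduced_smul_iff c C τ hr (schur H)]
    simp only [hre, hnorm]
    have hsch : ∀ (w : ι) (j : Fin m), ((r • schur H) w j j).re =
        r * (schur H w j j).re := fun w j => by simp [Complex.real_smul]
    simp only [hsch]
    refine and_congr ?_ (and_congr ?_ (and_congr ?_ (and_congr ?_ (and_congr ?_ Iff.rfl))))
    · refine forall_congr' fun w => ?_
      change (r • H w).IsHermitian ↔ (H w).IsHermitian
      refine ⟨fun h => ?_, fun h => Matrix.IsHermitian.smul h (IsSelfAdjoint.all r)⟩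
      have h' := Matrix.IsHermitian.smul h (IsSelfAdjoint.all r⁻¹)
      rwa [smul_smul, inv_mul_cancel₀ hr.ne', one_smul] at h'
    · exact forall_congr' fun w => mul_pos_iff_of_pos_left hr
    · refine forall_congr' fun w => forall_congr' fun w' => ?_
      rw [mul_left_comm, mul_lt_mul_iff_right₀ hr]
    · refine forall_congr' fun w => forall_congr' fun j => ?_
      rw [mul_left_comm, mul_lt_mul_iff_right₀ hr]
    · refine forall_congr' fun w => forall_congr' fun j => imp_congr_right fun _ => ?_
      rw [mul_left_comm, mul_lt_mul_iff_right₀ hr]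

end Reduced

end SiegelFamily

/-! ### `G ∩ GL_n(K)⁺` has finite index in `G ≤ GL_n(K)` -/

namespace ResGLnCohomology

section Index

variable {n : ℕ} {K : Type} [Field K] [NumberField K]

/-- **The totally positive part of a subgroup of `GL_n(K)` has finite index**: it is the kernel of the
real sign characters of `det`, a homomorphism to the finite group `(K →+* ℝ) → ℤˣ`. [folklore] -/
theorem finiteIndex_subgroupOf_glTotPos (G : Subgroup (GL (Fin n) K)) :
    ((glTotPos n K).subgroupOf G).FiniteIndex := by
  classical
  let s : ℝ → ℤˣ := fun x => if 0 < x then 1 else -1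
  have hs : ∀ x y : ℝ, x ≠ 0 → y ≠ 0 → s (x * y) = s x * s y := by
    intro x y hx hy
    rcases hx.lt_or_gt with hx | hx <;> rcases hy.lt_or_gt with hy | hy
    · simp [s, mul_pos_of_neg_of_neg hx hy, not_lt.2 hx.le, not_lt.2 hy.le]
    · simp [s, not_lt.2 (mul_neg_of_neg_of_pos hx hy).le, not_lt.2 hx.le, hy]
    · simp [s, not_lt.2 (mul_neg_of_pos_of_neg hx hy).le, hx, not_lt.2 hy.le]
    · simp [s, mul_pos hx hy, hx, hy]
  let d : GL (Fin n) K → (K →+* ℝ) → ℝ := fun g τ => τ ((Matrix.GeneralLinearGroup.det g : Kˣ) : K)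
  have hd0 : ∀ g τ, d g τ ≠ 0 := fun g τ => (map_ne_zero τ).2 (Matrix.GeneralLinearGroup.det g).ne_zero
  have hdmul : ∀ g h τ, d (g * h) τ = d g τ * d h τ := fun g h τ => by
    simp only [d, map_mul, Units.val_mul]
  have hd1 : ∀ τ, d 1 τ = 1 := fun τ => by simp [d]
  let φ : G →* ((K →+* ℝ) → ℤˣ) :=
    { toFun := fun g τ => s (d g τ)
      map_one' := by
        funext τ
        simp [s, hd1]
      map_mul' := fun g h => by
        funext τ
        simp only [Subgroup.coe_mul, Pi.mul_apply, hdmul]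
        exact hs _ _ (hd0 _ _) (hd0 _ _) }
  have hker : φ.ker ≤ (glTotPos n K).subgroupOf G := by
    intro g hg
    rw [Subgroup.mem_subgroupOf, mem_glTotPos_iff]
    intro τ
    have h1 : s (d g τ) = 1 := congrFun (MonoidHom.mem_ker.1 hg) τ
    by_contra hneg
    have h2 : s (d g τ) = -1 := if_neg hneg
    rw [h2] at h1
    exact absurd h1 (by decide)
  haveI : Finite (φ.range) := inferInstance
  exact Subgroup.finiteIndex_of_le hker

end Index

end ResGLnCohomology

end Literature.NumberTheory.Automorphic

end
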